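import Summits.NavierStokesRegularity.FluidComputer.GateBudgetColdAction
import HarnessLib

/-!
# GateBudget part 91 — the cold trigger floor: the trigger never reaches the seed scale on the
cold half in the credit regime (§262–§263)

Cell `pub-fluidc`, blueprint seat bp1 (gen 37 close-out: SPEC-INPUT-bp1 §BQ(4)(a0), the first
brick of the cold credit); namespace `Summit.NavierStokesRegularity.FluidComputer.GateBudget`,
headline member `RotorKnob.rotorCircuit K K¹⁰ ε ρ` from `delayInit` (5.6), `K ≥ 16`,
`ε² ≤ 1/(6K²⁰)`, `K¹⁰ρ² ≤ 2ε` (`σ = ρ²e^{-K¹⁰}`, `μ = ε⁻¹K¹⁰`); modes `0 = a` (carrier), `1 = b`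
(clock), `2 = c` (trigger), `3 = d` (transfer), `4 = ã` (output). Imports part 58
(`GateBudgetColdAction`: §176 `knob_cold_action`, §173 `cold_slopes`; through it part 56
`knob_trigger_memory` and part 18 `knob_trigger_pos`) only; independent of parts 59–90.
HONEST FRAMING: a low prior, high value-of-information experiment on Tao's machine paradigm; NOT a
claim that NS blows up. Nothing whatsoever is proved about the Navier–Stokes equations.
[cite: Tao2016AveragedNS, §5.5 Theorem 5.3, (5.5), (5.6), (b-eq), (c-eq), (energy-con), (est)]

WHY (SPEC-INPUT-bp1 §BQ(4)). Part 90 DEBITS the clock on the pulse half by the trigger's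
log-contraction `Λ = log((ρ²/K⁹)/c(T'))`; the cold half must CREDIT it back, because `log c` climbs
from `log c(T')` back to `log(ρ²/K⁹)` at the relight — by exactly `Λ` — and `(log c - μB)' = σa²/c`.
A credit is a LOWER bound on the cold action `B(r') - B(T')`, so it needs an UPPER bound on the
seed integral `∫σa²/c`, i.e. a FLOOR for `c` far above the seed scale `σ/μ` on the whole cold
window. This file: on a cold window `[T, u]` (`u ≤ T + 3`, `b(T) = -θε`, `P(T) ≤ 1/50`,
`c ≤ ρ²/K⁹` there, `c(T) ≥ (ρ²/K⁹)e^{-485K}` = part 84's exit floor) the action never drops below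
`-εθ²/(2s_l) ≥ -0.986ε` (part 58's lower action law, `s_l = 1 - P(T) - 8/K⁹`) PROVIDED
`θ ≤ 1.39` — the CREDIT REGIME, the complement of part 87's seed branch `θ' ≥ 1.39999` — so part
56's memory law keeps `c ≥ c(T)e^{-0.986K¹⁰}`, whence `σa² ≤ c/K³⁰`: the seed is invisible, and
`log c - μB` moves by at most `(t - T)/K³⁰ ≤ 3/K³⁰` over the cold half. At `θ² = 2s_l`
(`θ ≈ 1.40` for `P(T) = 1/50`) the exponent margin `1 - θ²/(2s_l)` vanishes, and beyond it the
decay `e^{-μ∫b}` over the clock's negative phase exceeds `e^{-K¹⁰}`: the trigger may fall to the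
seed scale, where the seed — not the action — relights it (part 60/87's second branch
`θ' ≥ 1.39999`); the restriction `θ ≤ 1.39` is that dichotomy, not an artefact of the method.

WHAT IS PROVED. §262 `cold_floor_numerics`; `knob_cold_trigger_floor` (`c > 0`, the action floor
`B(t) - B(T) ≥ -0.986ε`, the trigger floor `c(t) ≥ (ρ²/K⁹)e^{-485K}e^{-0.986K¹⁰}`, and the seed
bound `σa(t)² ≤ c(t)/K³⁰` on `[T, u]`). §263 `knob_cold_trigger_ledger` (the two-sided ledger
`μ(B(t) - B(T)) ≤ log c(t) - log c(T) ≤ μ(B(t) - B(T)) + (t - T)/K³⁰`) and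
`knob_cold_action_credit` (the action bracket `-0.986ε ≤ B(t) - B(T) ≤ 485ε/K⁹` on `[T, u]`, and at
a relight `c(r') = ρ²/K⁹`: `(ε/K¹⁰)(log(ρ²/K⁹) - log c(T) - (r' - T)/K³⁰) ≤ B(r') - B(T)`). Honest
limits: the credit regime `θ ≤ 1.39` only; the cold credit itself (the forward functional with a
time-dependent weight), the rung balance and the ladder are NOT in this file; constants generous;
nothing about Navier–Stokes.
-/

noncomputable section

namespace Summit.NavierStokesRegularity.FluidComputer.GateBudget

open Real Set
open Literature.Analysis.FluidPDE.Tao2016AveragedNS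

variable {K ε ρ : ℝ} {X : ℝ → Fin 5 → ℝ}

/-! ## §262 The cold trigger floor -/

/-- §262 NUMERICS OF THE CREDIT REGIME: for `K ≥ 16`, `0 ≤ θ ≤ 139/100`, `P₀ ≤ 1/50`:
`s_l = 1 - P₀ - 8/K⁹ > 0`, `θ²/(2s_l) ≤ 986/1000`, `39 log K + 485K + 0.986K¹⁰ ≤ K¹⁰`, `K³⁰ > 0`.
[derived: this file §262] -/
theorem cold_floor_numerics (hK : 16 ≤ K) {θ P₀ : ℝ} (hθ : 0 ≤ θ) (hθ1 : θ ≤ 139 / 100)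
    (hP0 : P₀ ≤ 1 / 50) :
    0 < 1 - P₀ - 8 / K ^ 9 ∧ θ ^ 2 / (2 * (1 - P₀ - 8 / K ^ 9)) ≤ 986 / 1000 ∧
      39 * log K + 485 * K + 986 / 1000 * K ^ 10 ≤ K ^ 10 ∧ (0 : ℝ) < K ^ 30 := by
  have hK0 : (0 : ℝ) < K := by linarith
  have h8 := (cold_slopes hK (by linarith : P₀ ≤ 1 / 2)).1
  have hs : 0 < 1 - P₀ - 8 / K ^ 9 := by linarith
  have hθ2 : θ ^ 2 ≤ (139 / 100) ^ 2 := pow_le_pow_left₀ hθ hθ1 2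
  refine ⟨hs, ?_, ?_, by positivity⟩
  · rw [div_le_iff₀ (by positivity)]
    nlinarith [hθ2, h8, hP0]
  · have hlog : log K ≤ K - 1 := Real.log_le_sub_one_of_pos hK0
    have h9 : (16 : ℝ) ^ 9 ≤ K ^ 9 := pow_le_pow_left₀ (by norm_num) hK 9
    have h10 : (68719476736 : ℝ) * K ≤ K ^ 10 := by
      calc (68719476736 : ℝ) * K = 16 ^ 9 * K := by norm_num
        _ ≤ K ^ 9 * K := mul_le_mul_of_nonneg_right h9 hK0.le
        _ = K ^ 10 := by ring
    nlinarith [hlog, h10, hK0]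

/-- §262 **THE COLD TRIGGER FLOOR (credit regime).** Headline member from (5.6), `K ≥ 16`,
`ε² ≤ 1/(6K²⁰)`, `K¹⁰ρ² ≤ 2ε`; a cold window `[T, u]`: `T ≥ 0`, `u ≤ T + 3`, `b(T) = -θε` with
`0 ≤ θ ≤ 139/100` (THE CREDIT REGIME), `d(T)² + ã(T)² ≤ 1/50`, `c ≤ ρ²/K⁹` on `[T, u]`, and the
exit floor `c(T) ≥ (ρ²/K⁹)e^{-485K}` (part 84 §246); `B` any clock action (`B' = b`). Then for
`t ∈ [T, u]`: `c(t) > 0`; the ACTION FLOOR `B(t) - B(T) ≥ -(986/1000)ε` (part 58 §176's lower law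
`ε(t - T)(s_l(t - T)/2 - θ) ≥ -εθ²/(2s_l)`); the TRIGGER FLOOR
`c(t) ≥ (ρ²/K⁹)e^{-485K}e^{-0.986K¹⁰}` (part 56 `knob_trigger_memory`); and the SEED BOUND
`ρ²e^{-K¹⁰}a(t)² ≤ c(t)/K³⁰` (`K³⁹ ≤ e^{0.014K¹⁰ - 485K}`).
[derived: this file §262; cite: Tao2016AveragedNS, §5.5 (c-eq)] -/
theorem knob_cold_trigger_floor
    (hX : ∀ t, HasDerivAt X (RotorKnob.rotorCircuit K (K ^ 10) ε ρ (X t)) t)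
    (h0 : X 0 = delayInit) (hK : 16 ≤ K) (hε : 0 < ε) (hεK : ε ^ 2 ≤ 1 / (6 * K ^ 20))
    (hρ : 0 < ρ) (hhi : K ^ 10 * ρ ^ 2 ≤ 2 * ε) {T u θ : ℝ} (hT : 0 ≤ T) (hu : u ≤ T + 3)
    (hθ : 0 ≤ θ) (hθ1 : θ ≤ 139 / 100) (hbT : X T 1 = -(θ * ε))
    (hP : X T 3 ^ 2 + X T 4 ^ 2 ≤ 1 / 50) (hc : ∀ t ∈ Icc T u, X t 2 ≤ ρ ^ 2 / K ^ 9)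
    (hℓ : ρ ^ 2 / K ^ 9 * exp (-(485 * K)) ≤ X T 2) {B : ℝ → ℝ}
    (hB : ∀ t, HasDerivAt B (X t 1) t) {t : ℝ} (ht : t ∈ Icc T u) :
    0 < X t 2 ∧ -(986 / 1000 * ε) ≤ B t - B T ∧
      ρ ^ 2 / K ^ 9 * exp (-(485 * K)) * exp (-(986 / 1000 * K ^ 10)) ≤ X t 2 ∧
      ρ ^ 2 * exp (-K ^ 10) * X t 0 ^ 2 ≤ X t 2 / K ^ 30 := by
  have hK0 : (0 : ℝ) < K := by linarith
  have hK10 : (0 : ℝ) ≤ K ^ 10 := by positivity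
  obtain ⟨hs, hq, hnum, hK30⟩ := cold_floor_numerics hK hθ hθ1 hP
  have hℓ0 : 0 < ρ ^ 2 / K ^ 9 * exp (-(485 * K)) := by positivity
  have hcT : 0 < X T 2 := hℓ0.trans_le hℓ
  have hpos : 0 < X t 2 := knob_trigger_pos hX h0 hε hK10 hT ht.1 hcT
  -- (1) the action floor: part 58's lower law and the minimum of its quadratic
  have hact := (knob_cold_action hX h0 hK hε hεK hρ hhi hT hu hθ (by linarith) hbT rfl hc hB
    ht).1
  obtain ⟨s, hs_def⟩ : ∃ s, s = 1 - (X T 3 ^ 2 + X T 4 ^ 2) - 8 / K ^ 9 := ⟨_, rfl⟩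
  rw [← hs_def] at hact hs hq
  have hmin : -(θ ^ 2 / (2 * s)) ≤ (t - T) * (s * (t - T) / 2 - θ) := by
    have h1 : ((t - T) * (s * (t - T) / 2 - θ) + θ ^ 2 / (2 * s)) * (2 * s)
        = (s * (t - T) - θ) ^ 2 := by
      field_simp
      ring
    have h2 : 0 ≤ ((t - T) * (s * (t - T) / 2 - θ) + θ ^ 2 / (2 * s)) * (2 * s) := by
      rw [h1]; exact sq_nonneg _
    have h3 : 0 ≤ (t - T) * (s * (t - T) / 2 - θ) + θ ^ 2 / (2 * s) :=
      nonneg_of_mul_nonneg_left h2 (by positivity)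
    linarith only [h3]
  have hquad : -(986 / 1000 * ε) ≤ B t - B T := by
    have h4 : ε * -(986 / 1000) ≤ ε * ((t - T) * (s * (t - T) / 2 - θ)) :=
      mul_le_mul_of_nonneg_left (by linarith only [hmin, hq]) hε.le
    linarith only [hact, h4]
  -- (2) the trigger floor: part 56's memory law
  have hmem := knob_trigger_memory hX h0 hε hK10 hB hT ht.1 hcT
  have hexp : exp (-(986 / 1000 * K ^ 10)) ≤ exp (ε⁻¹ * K ^ 10 * (B t - B T)) := by
    apply Real.exp_le_exp.2
    have h4 : -(986 / 1000) ≤ ε⁻¹ * (B t - B T) := by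
      have h5 := mul_le_mul_of_nonneg_left hquad (inv_pos.2 hε).le
      rwa [show ε⁻¹ * -(986 / 1000 * ε) = -(986 / 1000) by field_simp] at h5
    have h6 := mul_le_mul_of_nonneg_left h4 hK10
    have h7 : ε⁻¹ * K ^ 10 * (B t - B T) = K ^ 10 * (ε⁻¹ * (B t - B T)) := by ring
    rw [h7]
    linarith only [h6]
  have hfloor : ρ ^ 2 / K ^ 9 * exp (-(485 * K)) * exp (-(986 / 1000 * K ^ 10)) ≤ X t 2 :=
    (mul_le_mul hℓ hexp (exp_pos _).le hcT.le).trans hmem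
  refine ⟨hpos, hquad, hfloor, ?_⟩
  -- (3) the seed bound: K³⁹ ≤ exp(K¹⁰ - 485K - 0.986K¹⁰)
  have h39 : K ^ 39 ≤ exp (K ^ 10 - 485 * K - 986 / 1000 * K ^ 10) := by
    calc K ^ 39 = exp (log (K ^ 39)) := (Real.exp_log (by positivity)).symm
      _ = exp (39 * log K) := by rw [Real.log_pow]; norm_num
      _ ≤ exp (K ^ 10 - 485 * K - 986 / 1000 * K ^ 10) :=
          Real.exp_le_exp.2 (by linarith only [hnum])
  have ha2 : X t 0 ^ 2 ≤ 1 := by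
    have h := RotorKnob.traj_abs_le_one hX h0 t 0
    rw [← sq_abs]
    nlinarith [abs_nonneg (X t 0), h]
  have hK39 : (0 : ℝ) < K ^ 39 := by positivity
  have hE : ρ ^ 2 / K ^ 9 * exp (-(485 * K)) * exp (-(986 / 1000 * K ^ 10)) / K ^ 30
      = ρ ^ 2 * exp (-K ^ 10) * exp (K ^ 10 - 485 * K - 986 / 1000 * K ^ 10) / K ^ 39 := by
    rw [show exp (K ^ 10 - 485 * K - 986 / 1000 * K ^ 10)
        = exp (K ^ 10) * (exp (-(485 * K)) * exp (-(986 / 1000 * K ^ 10))) by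
          rw [← Real.exp_add, ← Real.exp_add]; congr 1; ring,
      show exp (-K ^ 10) = (exp (K ^ 10))⁻¹ by rw [Real.exp_neg]]
    field_simp
  calc ρ ^ 2 * exp (-K ^ 10) * X t 0 ^ 2 ≤ ρ ^ 2 * exp (-K ^ 10) * 1 :=
        mul_le_mul_of_nonneg_left ha2 (by positivity)
    _ = ρ ^ 2 * exp (-K ^ 10) * K ^ 39 / K ^ 39 := by field_simp
    _ ≤ ρ ^ 2 * exp (-K ^ 10) * exp (K ^ 10 - 485 * K - 986 / 1000 * K ^ 10) / K ^ 39 := by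
        gcongr
    _ = ρ ^ 2 / K ^ 9 * exp (-(485 * K)) * exp (-(986 / 1000 * K ^ 10)) / K ^ 30 := hE.symm
    _ ≤ X t 2 / K ^ 30 := by gcongr

/-! ## §263 The cold trigger ledger and the action credit -/

/-- §263 **THE COLD TRIGGER LEDGER.** Under §262's hypotheses, for `t ∈ [T, u]`:
`μ(B(t) - B(T)) ≤ log c(t) - log c(T) ≤ μ(B(t) - B(T)) + (t - T)/K³⁰` (`μ = ε⁻¹K¹⁰`) — the lower
half is part 56's memory law (`(log c - μB)' = σa²/c ≥ 0`), the upper half is the seed bound of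
§262 (`σa²/c ≤ 1/K³⁰`, so `log c - μB - t/K³⁰` is antitone). On the cold half the trigger's
logarithm IS the action, up to `3/K³⁰`. [derived: this file §263; cite: Tao2016AveragedNS, §5.5
(c-eq)] -/
theorem knob_cold_trigger_ledger
    (hX : ∀ t, HasDerivAt X (RotorKnob.rotorCircuit K (K ^ 10) ε ρ (X t)) t)
    (h0 : X 0 = delayInit) (hK : 16 ≤ K) (hε : 0 < ε) (hεK : ε ^ 2 ≤ 1 / (6 * K ^ 20))
    (hρ : 0 < ρ) (hhi : K ^ 10 * ρ ^ 2 ≤ 2 * ε) {T u θ : ℝ} (hT : 0 ≤ T) (hu : u ≤ T + 3)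
    (hθ : 0 ≤ θ) (hθ1 : θ ≤ 139 / 100) (hbT : X T 1 = -(θ * ε))
    (hP : X T 3 ^ 2 + X T 4 ^ 2 ≤ 1 / 50) (hc : ∀ t ∈ Icc T u, X t 2 ≤ ρ ^ 2 / K ^ 9)
    (hℓ : ρ ^ 2 / K ^ 9 * exp (-(485 * K)) ≤ X T 2) {B : ℝ → ℝ}
    (hB : ∀ t, HasDerivAt B (X t 1) t) {t : ℝ} (ht : t ∈ Icc T u) :
    ε⁻¹ * K ^ 10 * (B t - B T) ≤ log (X t 2) - log (X T 2) ∧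
      log (X t 2) - log (X T 2) ≤ ε⁻¹ * K ^ 10 * (B t - B T) + (t - T) / K ^ 30 := by
  have hK0 : (0 : ℝ) < K := by linarith
  have hK10 : (0 : ℝ) ≤ K ^ 10 := by positivity
  have hfl := fun r (hr : r ∈ Icc T u) =>
    knob_cold_trigger_floor hX h0 hK hε hεK hρ hhi hT hu hθ hθ1 hbT hP hc hℓ hB hr
  have hTu : T ≤ u := ht.1.trans ht.2
  have hcT : 0 < X T 2 := (hfl T (left_mem_Icc.2 hTu)).1
  constructor
  · have hmem := knob_trigger_memory hX h0 hε hK10 hB hT ht.1 hcT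
    have h1 := Real.log_le_log (mul_pos hcT (exp_pos _)) hmem
    rw [Real.log_mul hcT.ne' (exp_pos _).ne', Real.log_exp] at h1
    linarith only [h1]
  · -- `Φ(r) = log c(r) - μB(r) - r/K³⁰` is antitone on `[T, u]`
    have hg : ∀ r ∈ Icc T u, HasDerivAt (fun r => log (X r 2) - ε⁻¹ * K ^ 10 * B r - r / K ^ 30)
        ((ρ ^ 2 * exp (-K ^ 10) * X r 0 ^ 2 + ε⁻¹ * K ^ 10 * X r 1 * X r 2) / X r 2
          - ε⁻¹ * K ^ 10 * X r 1 - 1 / K ^ 30) r := fun r hr =>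
      (((RotorKnob.hasDerivAt_c hX r).log (hfl r hr).1.ne').sub ((hB r).const_mul _)).sub
        ((hasDerivAt_id' r).div_const (K ^ 30))
    have hanti : AntitoneOn (fun r => log (X r 2) - ε⁻¹ * K ^ 10 * B r - r / K ^ 30)
        (Icc T u) := by
      refine antitoneOn_of_deriv_nonpos (convex_Icc T u)
        (fun r hr => (hg r hr).continuousAt.continuousWithinAt)
        (fun r hr => (hg r (interior_subset hr)).differentiableAt.differentiableWithinAt)
        fun r hr => ?_
      have hr' := interior_subset hr
      obtain ⟨hcr, -, -, hseed⟩ := hfl r hr'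
      rw [(hg r hr').deriv, show (ρ ^ 2 * exp (-K ^ 10) * X r 0 ^ 2
          + ε⁻¹ * K ^ 10 * X r 1 * X r 2) / X r 2 - ε⁻¹ * K ^ 10 * X r 1 - 1 / K ^ 30
          = (ρ ^ 2 * exp (-K ^ 10) * X r 0 ^ 2 - X r 2 / K ^ 30) / X r 2 by
            field_simp
            ring]
      exact div_nonpos_iff.2 (Or.inr ⟨by linarith only [hseed], hcr.le⟩)
    have h1 := hanti (left_mem_Icc.2 hTu) ht ht.1
    simp only at h1
    have h2 : (t - T) / K ^ 30 = t / K ^ 30 - T / K ^ 30 := sub_div _ _ _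
    rw [h2, mul_sub]
    linarith only [h1]

/-- §263 **THE COLD ACTION CREDIT.** Under §262's hypotheses: for every `t ∈ [T, u]` the action
bracket `-(986/1000)ε ≤ B(t) - B(T) ≤ 485ε/K⁹` (upper: the ledger's lower half with
`c(t) ≤ ρ²/K⁹ ≤ c(T)e^{485K}`); and if the trigger relights at `r' ∈ [T, u]`, `c(r') = ρ²/K⁹`,
then the cold half has SPENT the action `(ε/K¹⁰)(log(ρ²/K⁹) - log c(T) - (r' - T)/K³⁰) ≤
B(r') - B(T)` — the trigger's whole log-climb back, `Λ_T = log((ρ²/K⁹)/c(T))`, minus at most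
`3/K³⁰`. With `T = T'` = part 84's pulse exit this `Λ_T` is EXACTLY part 90's `Λ`: the credit
matches the debit. [derived: this file §263] -/
theorem knob_cold_action_credit
    (hX : ∀ t, HasDerivAt X (RotorKnob.rotorCircuit K (K ^ 10) ε ρ (X t)) t)
    (h0 : X 0 = delayInit) (hK : 16 ≤ K) (hε : 0 < ε) (hεK : ε ^ 2 ≤ 1 / (6 * K ^ 20))
    (hρ : 0 < ρ) (hhi : K ^ 10 * ρ ^ 2 ≤ 2 * ε) {T u θ : ℝ} (hT : 0 ≤ T) (hu : u ≤ T + 3)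
    (hθ : 0 ≤ θ) (hθ1 : θ ≤ 139 / 100) (hbT : X T 1 = -(θ * ε))
    (hP : X T 3 ^ 2 + X T 4 ^ 2 ≤ 1 / 50) (hc : ∀ t ∈ Icc T u, X t 2 ≤ ρ ^ 2 / K ^ 9)
    (hℓ : ρ ^ 2 / K ^ 9 * exp (-(485 * K)) ≤ X T 2) {B : ℝ → ℝ}
    (hB : ∀ t, HasDerivAt B (X t 1) t) :
    (∀ t ∈ Icc T u, -(986 / 1000 * ε) ≤ B t - B T ∧ B t - B T ≤ 485 * ε / K ^ 9) ∧
      ∀ r' ∈ Icc T u, X r' 2 = ρ ^ 2 / K ^ 9 →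
        ε / K ^ 10 * (log (ρ ^ 2 / K ^ 9) - log (X T 2) - (r' - T) / K ^ 30) ≤ B r' - B T := by
  have hK0 : (0 : ℝ) < K := by linarith
  have hK10 : (0 : ℝ) < K ^ 10 := by positivity
  have hq0 : 0 < ρ ^ 2 / K ^ 9 := by positivity
  have hcT : 0 < X T 2 := lt_of_lt_of_le (by positivity) hℓ
  -- `log c(T) ≥ log(ρ²/K⁹) - 485K`
  have hlT : log (ρ ^ 2 / K ^ 9) - 485 * K ≤ log (X T 2) := by
    have h1 := Real.log_le_log (by positivity) hℓ
    rwa [Real.log_mul hq0.ne' (exp_pos _).ne', Real.log_exp] at h1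
  have hled := fun r (hr : r ∈ Icc T u) =>
    knob_cold_trigger_ledger hX h0 hK hε hεK hρ hhi hT hu hθ hθ1 hbT hP hc hℓ hB hr
  have hfl := fun r (hr : r ∈ Icc T u) =>
    knob_cold_trigger_floor hX h0 hK hε hεK hρ hhi hT hu hθ hθ1 hbT hP hc hℓ hB hr
  have hεK10 : 0 < ε / K ^ 10 := by positivity
  have hunit : ∀ y : ℝ, ε / K ^ 10 * (ε⁻¹ * K ^ 10 * y) = y := fun y => by
    field_simp
  refine ⟨fun t ht => ⟨(hfl t ht).2.1, ?_⟩, fun r' hr' hcr => ?_⟩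
  · have h1 := (hled t ht).1
    have h2 := Real.log_le_log (hfl t ht).1 (hc t ht)
    have h3 : ε⁻¹ * K ^ 10 * (B t - B T) ≤ 485 * K := by linarith only [h1, h2, hlT]
    have h4 := mul_le_mul_of_nonneg_left h3 hεK10.le
    rw [hunit] at h4
    have h5 : ε / K ^ 10 * (485 * K) = 485 * ε / K ^ 9 := by
      field_simp
    linarith only [h4, h5]
  · have h1 := (hled r' hr').2
    rw [hcr] at h1
    have h3 : log (ρ ^ 2 / K ^ 9) - log (X T 2) - (r' - T) / K ^ 30
        ≤ ε⁻¹ * K ^ 10 * (B r' - B T) := by linarith only [h1]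
    have h4 := mul_le_mul_of_nonneg_left h3 hεK10.le
    rwa [hunit] at h4

end Summit.NavierStokesRegularity.FluidComputer.GateBudget
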